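import Summits.HodgeConjecture.HodgeConjecture.Theorems.MarkmanPartnerTransportK3Sq2KugaSatakeMixedMultiplier

/-!
# Route MarkmanPartnerTransport · support `PartnerTransport` (stmt-HodgeConjecture-19650) ∕ crux #4 —
# programme «KS-MIXED», step M1 (direction `X → S`): bijectivity and multiplier of the restriction
# `h_T : T(X)_ℚ → T(S)_ℚ` of a rational transcendental Hodge map `H²(X) → H²(S)`

The `X → S` twins of `…MixedPresentation` §4 and `…MixedMultiplier` §6 (marked `K3^{[2]}`-type fourfold `X`, surface
`S` with `h^{2,0} = 1`, `h : H²(X(ℂ); ℂ) → H²(S(ℂ); ℂ)` rational, type-preserving, with cup-transcendental image):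

* `apply_baseChange_eq_XS`, `hom_transcendental_bijective_XS` — `h_T` is BIJECTIVE when `h` maps `T(X)_ℂ`
  injectively onto `T(S)_ℂ`;
* `exists_rat_multiplier_XS` — a complex multiplier `∫_S h y ∪ h w = μ' q(φ y, φ w)` on `T(X)_ℂ` is a rational
  multiplier `m' ≠ 0` between `−q_B|_{T(X)}` and the polarization `P = ε∫` of `T(S)_ℚ`.

THEOREMS ONLY; no sorry, no definition, no named fact; nothing here says HC or any item is proved. Prover seat
hodge-nonav-19652-p1 (gen 16), `--supports stmt-HodgeConjecture-19650` (blueprint «KS-MIXED»).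

References: M. Varesco, Math. Z. 305 (2023) §4, Cor. 4.6, Def. 1.2; D. Huybrechts, *Lectures on K3 Surfaces* Ch. 3
Lemma 3.1; C. Voisin, *Hodge Theory I* §7.1.1.
-/

set_option linter.dupNamespace false

noncomputable section

namespace Summit.HodgeConjecture.HodgeConjecture.Theorems.MarkmanPartnerTransport.KugaSatakeMixed

open scoped TensorProduct
open CategoryTheory MonoidalCategory Literature.AlgebraicGeometry Literature.AlgebraicGeometry.Motives
open Literature.AlgebraicGeometry.HodgeTheory Literature.AlgebraicTopology.SingularHomology
open Literature.AlgebraicGeometry.Motives.HodgeStructure Literature.AlgebraicGeometry.Hyperkaehler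
open Literature.AlgebraicGeometry.Surfaces
open Summit.HodgeConjecture.HodgeConjecture.Theorems.OddPrimeSquares
open Summit.HodgeConjecture.HodgeConjecture.Theorems.NikulinTwinTransport
open Summit.HodgeConjecture.HodgeConjecture.Theorems.MarkmanPartnerTransport.TranscendentalPresentation
open Summit.HodgeConjecture.HodgeConjecture.Theorems.MarkmanPartnerTransport.KugaSatakeSelf
open Summit.HodgeConjecture.HodgeConjecture.Theorems.MarkmanPartnerTransport.KugaSatakePair
open Summit.HodgeConjecture.HodgeConjecture.Theorems.MarkmanPartnerTransport.KugaSatakeHK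

variable {S X : SchemeOver ℂ} {φ : complexBetti X 2 ≃ₗ[ℂ] (K3HilbertIndex → ℂ)} {PX : complexBetti X (2 * 4)}
  {z : K3HilbertIndex → ℂ}

/-- `MarkedK3Sq[X, φ, P, z]`: VERBATIM the `let MarkedK3Sq := …` binder of the route declarations of
MarkmanPartnerTransport (clauses (m1)–(m6)). Local notation only. -/
local notation3 (prettyPrint := false) "MarkedK3Sq[" X ", " φ ", " P ", " z "]" =>
  (((IsIntegralClass P ∧ ∀ Q : complexBetti X (2 * 4), IsIntegralClass Q → ∃ n : ℤ, Q = n • P) ∧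
    (∀ c : complexBetti X 2, IsIntegralClass c ↔ ∃ v : K3HilbertIndex → ℤ, φ c = fun i => (v i : ℂ)) ∧
    (∀ a : complexBetti X 2, cupPowTwo a 4 = ((3 : ℂ) * (k3HilbertForm 2 (φ a) (φ a)) ^ 2) • P) ∧
    (IsOfHodgeType 4 X 2 2 0 (LinearEquiv.symm φ z) ∧
      ∀ τ : complexBetti X 2, IsOfHodgeType 4 X 2 2 0 τ → ∃ t : ℂ, τ = t • LinearEquiv.symm φ z) ∧
    (∀ c : complexBetti X 2, IsOfHodgeType 4 X 2 1 1 c ↔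
      (k3HilbertForm 2 (φ c) z = 0 ∧ k3HilbertForm 2 (φ c) (star z) = 0)) ∧
    (k3HilbertForm 2 z z = 0 ∧ 0 < (k3HilbertForm 2 (star z) z).re)))

/-- `H²[hS]`: the weight-two `ℚ`-Hodge structure on `H²(S(ℂ); ℚ)` of the real Hodge model of the surface `S`. -/
local notation3 "H²[" hS "]" =>
  bettiTwoHodgeStructure hS (BettiUniverse.realHodgeModel exists_isReal_hodgeModel_holds hS)
    (BettiUniverse.realHodgeModel_isHodgeSymmetric exists_isReal_hodgeModel_holds hS)

/-- `T[hS] = T(S)_ℚ = Hdg¹^⊥ ⊆ H²(S(ℂ); ℚ)`. -/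
local notation3 "T[" hS "]" =>
  transcendentalLatticeBetti hS (BettiUniverse.realHodgeModel exists_isReal_hodgeModel_holds hS)
    (BettiUniverse.realHodgeModel_isHodgeSymmetric exists_isReal_hodgeModel_holds hS)

/-- `H²_B[hX]`: the weight-two `ℚ`-Hodge structure on `H²(X(ℂ); ℚ)` of the real Hodge model of the fourfold `X`
(`hX : IsSmoothProjective (2 * 2) X`). -/
local notation3 "H²_B[" hX "]" =>
  bettiTwoHodgeStructureOfModel hX (BettiUniverse.realHodgeModel exists_isReal_hodgeModel_holds hX)
    (BettiUniverse.realHodgeModel_isHodgeSymmetric exists_isReal_hodgeModel_holds hX)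

/-- `Θ : ℂ ⊗_ℚ H²(Y(ℂ); ℚ) → H²(Y(ℂ); ℂ)` (`Y = S` or `X`). -/
local notation3 "Θ[" Y "]" => ofRatClassBaseChange (Motives.ComplexPoints Y) (2 * 1)

/-- `ι : H²(Y(ℂ); ℚ) → H²(Y(ℂ); ℂ)`, the rational lattice (`Y = S` or `X`). -/
local notation3 "ι[" Y "]" => ofRatClass (Motives.ComplexPoints Y) (2 * 1)

/-- `Transc[S, y]`: `y` is cup-orthogonal to `N¹(S) = algebraicClasses S 1`. Local notation only. -/
local notation3 (prettyPrint := false) "Transc[" S ", " y "]" =>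
  (∀ d ∈ algebraicClasses S 1, cupProduct (rfl : 2 * 1 + 2 * 1 = 2 * 2) y d = 0)

/-- `BBF[X, φ, y]`: `y` is `q`-orthogonal to `N¹(X) = algebraicClasses X 1` (the route's `IsBBFTransc`). -/
local notation3 (prettyPrint := false) "BBF[" X ", " φ ", " y "]" =>
  (∀ e : complexBetti X 2, e ∈ algebraicClasses X 1 → k3HilbertForm 2 (φ y) (φ e) = 0)

/-! ### §1 Bijectivity of `h_T` -/

section Bijective

variable {hS : IsSmoothProjective 2 S} {hX : IsSmoothProjective (2 * 2) X}
  {T : SubHodgeStructure (H²[hS])} {T' : SubHodgeStructure (H²_B[hX])}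
  {h : complexBetti X 2 →ₗ[ℂ] complexBetti S (2 * 1)} {hT : Hom T'.toHodgeStructure T.toHodgeStructure}

/-- `h ∘ Θ_X ∘ (ι_{T'} ⊗ ℂ) = Θ_S ∘ (ι_T ⊗ ℂ) ∘ (h_T ⊗ ℂ)` on `ℂ ⊗ T'`. [folklore] -/
theorem apply_baseChange_eq_XS
    (hhT : ∀ t' : T'.toSubmodule, ι[S] ((hT.toLinearMap t' : T.toSubmodule) : bettiCohomology S (2 * 1)) =
      h (ι[X] (t' : bettiCohomology X (2 * 1))))
    (x' : ℂ ⊗[ℚ] T'.toSubmodule) :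
    h (Θ[X] (T'.toSubmodule.subtype.baseChange ℂ x')) =
      Θ[S] (T.toSubmodule.subtype.baseChange ℂ (hT.toLinearMap.baseChange ℂ x')) := by
  induction x' using TensorProduct.induction_on with
  | zero => simp only [map_zero]
  | tmul c t =>
    rw [LinearMap.baseChange_tmul, Submodule.subtype_apply, ofRatClassBaseChange_tmul, map_smul,
      LinearMap.baseChange_tmul, LinearMap.baseChange_tmul, Submodule.subtype_apply, ofRatClassBaseChange_tmul, hhT]
  | add x y hx hy => simp only [map_add, hx, hy]

/-- **`h_T : T(X)_ℚ → T(S)_ℚ` is BIJECTIVE** when `h` is injective on `T(X)_ℂ` and maps it onto `T(S)_ℂ` (injective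
directly; the complexification is bijective, so the dimensions agree). [cite: Varesco2023, Def. 1.2]
[cite: Huybrechts2016K3, Ch. 3 Lemma 3.1] -/
theorem hom_transcendental_bijective_XS (hM : MarkedK3Sq[X, φ, PX, z]) (hTS : T.toSubmodule = T[hS])
    (hT' : ∀ x : bettiCohomology X (2 * 1), x ∈ T'.toSubmodule ↔
      ∀ k ∈ (H²_B[hX]).hodgeClasses 1, k3HilbertForm 2 (φ (ι[X] x)) (φ (ι[X] k)) = 0)
    (hhT : ∀ t' : T'.toSubmodule, ι[S] ((hT.toLinearMap t' : T.toSubmodule) : bettiCohomology S (2 * 1)) =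
      h (ι[X] (t' : bettiCohomology X (2 * 1))))
    (hinj : ∀ y : complexBetti X 2, BBF[X, φ, y] → h y = 0 → y = 0)
    (hsurj : ∀ y' : complexBetti S (2 * 1), Transc[S, y'] → ∃ y, BBF[X, φ, y] ∧ h y = y') :
    Function.Bijective hT.toLinearMap := by
  haveI := BettiUniverse.finite hS (2 * 1); haveI := BettiUniverse.finite hX (2 * 1)
  haveI := Module.Finite.of_injective T.toSubmodule.subtype T.toSubmodule.injective_subtype
  haveI := Module.Finite.of_injective T'.toSubmodule.subtype T'.toSubmodule.injective_subtype
  have hi : Function.Injective hT.toLinearMap := by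
    rw [injective_iff_map_eq_zero]
    intro t' ht'
    have h0 : h (ι[X] (t' : bettiCohomology X (2 * 1))) = 0 := by
      rw [← hhT, ht', Submodule.coe_zero, map_zero]
    have htr : BBF[X, φ, ι[X] (t' : bettiCohomology X (2 * 1))] :=
      (bbfTransc_iff_hodgeClasses hX _).2 ((hT' _).1 t'.2)
    have h1 := hinj _ htr h0
    apply Subtype.ext
    exact ofRatClass_injective (Y := Motives.ComplexPoints X) (2 * 1) (by rw [h1, Submodule.coe_zero, map_zero])
  have hIS : Function.Injective (fun x : ℂ ⊗[ℚ] T.toSubmodule => Θ[S] (T.toSubmodule.subtype.baseChange ℂ x)) :=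
    fun x y hxy => baseChange_injective_of_injective T.toSubmodule.injective_subtype
      (ofRatClassBaseChange_injective _ _ hxy)
  have hCinj : Function.Injective (hT.toLinearMap.baseChange ℂ) := baseChange_injective_of_injective hi
  have hCsurj : Function.Surjective (hT.toLinearMap.baseChange ℂ) := by
    intro x
    obtain ⟨y, hy, hyx⟩ := hsurj _ (transc_of_baseChange hS T hTS x)
    obtain ⟨x', rfl⟩ := exists_baseChange_eq_of_bbfTransc hX hM T' hT' hy
    refine ⟨x', hIS ?_⟩
    change Θ[S] (T.toSubmodule.subtype.baseChange ℂ (hT.toLinearMap.baseChange ℂ x')) =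
      Θ[S] (T.toSubmodule.subtype.baseChange ℂ x)
    rw [← apply_baseChange_eq_XS hhT, hyx]
  have hdim : Module.finrank ℚ T'.toSubmodule = Module.finrank ℚ T.toSubmodule := by
    rw [← Module.finrank_baseChange (R := ℂ) (S := ℚ), ← Module.finrank_baseChange (R := ℂ) (S := ℚ),
      (LinearEquiv.ofBijective _ ⟨hCinj, hCsurj⟩).finrank_eq]
  exact ⟨hi, (LinearMap.injective_iff_surjective_of_finrank_eq_finrank hdim).1 hi⟩

end Bijective

/-! ### §2 The multiplier of `h` between the two polarizations is rational -/

/-- **A complex multiplier `∫_S h y ∪ h w = μ' q(φ y, φ w)` on `T(X)_ℂ` is a rational multiplier between the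
polarizations**: with `(T', Pol = −q_B|_{T'}, T' ↪ H²_B(X))` presenting `X` for `b = −q ∘ (φ × φ)`, `(T, P = ε∫, T ↪ H²_B(S))`
presenting `S`, `h_T : Hom T' T` the restriction of `h` and `μ' ≠ 0`: `P(h_T a, h_T c) = m' · Pol(a, c)` on `T'` for a
rational `m' ≠ 0` (`= −ε μ'`; `Pol` is non-degenerate on `T' ≠ 0`). [cite: Varesco2023, Def. 1.2 and Rem. 2.2]
[cite: Huybrechts2016K3, Ch. 3 Lemma 3.1] -/
theorem exists_rat_multiplier_XS (hS : IsSmoothProjective 2 S) (hX : IsSmoothProjective (2 * 2) X)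
    {T : SubHodgeStructure (H²[hS])} {T' : SubHodgeStructure (H²_B[hX])}
    {P : T.toHodgeStructure.Polarization} {ε : ℤˣ}
    (hj : IsTranscendentalPartBetti hS _ _ T.toHodgeStructure P ε T.subtypeHom)
    {b : complexBetti X 2 →ₗ[ℂ] complexBetti X 2 →ₗ[ℂ] ℂ} (hbq : ∀ x y, b x y = -k3HilbertForm 2 (φ x) (φ y))
    {Pol : T'.toHodgeStructure.Polarization}
    (hj' : IsTranscendentalPartHK hX _ _ b T'.toHodgeStructure Pol T'.subtypeHom) (hT'0 : T'.toSubmodule ≠ ⊥)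
    (hT' : ∀ x : bettiCohomology X (2 * 1), x ∈ T'.toSubmodule ↔
      ∀ k ∈ (H²_B[hX]).hodgeClasses 1, k3HilbertForm 2 (φ (ι[X] x)) (φ (ι[X] k)) = 0)
    {h : complexBetti X 2 →ₗ[ℂ] complexBetti S (2 * 1)} {hT : Hom T'.toHodgeStructure T.toHodgeStructure}
    (hhT : ∀ t' : T'.toSubmodule, ι[S] ((hT.toLinearMap t' : T.toSubmodule) : bettiCohomology S (2 * 1)) =
      h (ι[X] (t' : bettiCohomology X (2 * 1))))
    {μ' : ℂ} (hμ' : μ' ≠ 0)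
    (hmul : ∀ y w : complexBetti X 2, BBF[X, φ, y] → BBF[X, φ, w] →
      traceC hS (cupProduct (rfl : 2 * 1 + 2 * 1 = 2 * 2) (h y) (h w)) = μ' * k3HilbertForm 2 (φ y) (φ w)) :
    ∃ m' : ℚ, m' ≠ 0 ∧ ∀ a c : T'.toSubmodule,
      P.form (hT.toLinearMap a) (hT.toLinearMap c) = m' * Pol.form a c := by
  have hform := ((isTranscendentalPartBetti_iff hS _ _ _ P ε T.subtypeHom).1 hj).2.2
  -- the complex identity on `T(X)_ℚ`
  have key : ∀ a c : T'.toSubmodule,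
      ((P.form (hT.toLinearMap a) (hT.toLinearMap c) : ℚ) : ℂ) = (-(((ε : ℤ) : ℂ) * μ')) * ((Pol.form a c : ℚ) : ℂ) := by
    intro a c
    have ha : BBF[X, φ, ι[X] (a : bettiCohomology X (2 * 1))] := (bbfTransc_iff_hodgeClasses hX _).2 ((hT' _).1 a.2)
    have hc : BBF[X, φ, ι[X] (c : bettiCohomology X (2 * 1))] := (bbfTransc_iff_hodgeClasses hX _).2 ((hT' _).1 c.2)
    have hq : k3HilbertForm 2 (φ (ι[X] (a : bettiCohomology X (2 * 1)))) (φ (ι[X] (c : bettiCohomology X (2 * 1)))) =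
        -((Pol.form a c : ℚ) : ℂ) := by
      rw [hj'.2.2, SubHodgeStructure.subtypeHom_toLinearMap, Submodule.subtype_apply, Submodule.subtype_apply, hbq,
        neg_neg]
    rw [hform, SubHodgeStructure.subtypeHom_toLinearMap, Submodule.subtype_apply, Submodule.subtype_apply, Rat.cast_mul,
      algebraMap_cupPairingBetti, Rat.cast_intCast, hhT, hhT, hmul _ _ ha hc, hq]
    ring
  -- some `Pol(a, c) ≠ 0` on `T' ≠ 0`
  obtain ⟨a₀, c₀, hac⟩ : ∃ a c : T'.toSubmodule, Pol.form a c ≠ 0 := by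
    obtain ⟨a, ha, ha0⟩ := (Submodule.ne_bot_iff _).1 hT'0
    by_contra hall
    push Not at hall
    have h0 : (⟨a, ha⟩ : T'.toSubmodule) = 0 := Pol.nondegenerate.1 _ (fun c => hall ⟨a, ha⟩ c)
    exact ha0 (congrArg Subtype.val h0)
  set q₁ := P.form (hT.toLinearMap a₀) (hT.toLinearMap c₀) with hq₁
  set q₂ := Pol.form a₀ c₀ with hq₂
  have hνq : -(((ε : ℤ) : ℂ) * μ') = ((q₁ / q₂ : ℚ) : ℂ) := by
    have hk := key a₀ c₀
    rw [← hq₁, ← hq₂] at hk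
    have hq₂' : ((q₂ : ℚ) : ℂ) ≠ 0 := by exact_mod_cast hac
    rw [Rat.cast_div, eq_div_iff hq₂', hk]
  refine ⟨q₁ / q₂, ?_, fun a c => ?_⟩
  · intro h0
    have hε0 : ((ε : ℤ) : ℂ) ≠ 0 := by exact_mod_cast Units.ne_zero ε
    apply mul_ne_zero hε0 hμ'
    have hk := hνq
    rw [h0, Rat.cast_zero, neg_eq_zero] at hk
    exact hk
  · have hk := key a c
    rw [hνq, ← Rat.cast_mul] at hk
    exact_mod_cast hk

end Summit.HodgeConjecture.HodgeConjecture.Theorems.MarkmanPartnerTransport.KugaSatakeMixed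

end
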